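import Literature.AlgebraicGeometry.HodgeTheory.MonodromyWeightFiltrationSl2
import Mathlib.LinearAlgebra.Dual.Lemmas
import HarnessLib

/-!
# The monodromy weight filtration of a direct sum and of a dual (Deligne, Weil II, (1.6.7), (1.6.9) (ii))

Topic `Literature/AlgebraicGeometry/HodgeTheory` (namespace `Literature.AlgebraicGeometry.HodgeTheory`). Compatibilities of
the structure `IsMonodromyWeightFiltration N c W` (`MonodromyWeightFiltration.lean`: axioms (1) `N W_i ⊂ W_{i−2}`, (2)
`N^ℓ : Gr_{c+ℓ} ⥲ Gr_{c−ℓ}` in lattice form; uniqueness) with direct sums, change of sign of `N`, and transposition.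
THEOREMS ONLY (no definition, no instance, no named fact; net debt `0`).

PRINTED RESULTS (P. Deligne, *La conjecture de Weil. II*, Publ. Math. IHÉS 52 (1980), §(1.6); held text
`paper:doi-10-1007-bf02684780`), VERBATIM:
* (1.6.7) (p0031), after the description of `M` for one Jordan block: «En général, `V` est somme de sous-espaces `V_α`
  stables par `N`, avec `N` du type (1.6.7.1) sur `V_α`, et la filtration `M` de `V` est somme des filtrations ci-dessus
  des `V_α`.»
* Remarque (1.6.2) (p0030): «La caractérisation (1.6.1) de `M` montre sa compatibilité au passage à la catégorie duale.»
* PROPOSITION (1.6.9) (p0032): «Définissons le produit tensoriel … et le dual de `(V', N')` comme étant `(V'^*, −ᵗN')`.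
  … (ii) La filtration `M` d'un dual est le dual de la filtration `M` de l'espace de départ (`M_i(V^*) = M_{−1−i}(V)^⊥`).»

THIS FILE (all proved):
* §1 DIRECT SUMS (any commutative ring): **`IsMonodromyWeightFiltration.prod`** — if `W₁`, `W₂` are monodromy weight
  filtrations of `N₁` on `V₁` and `N₂` on `V₂`, both centred at `c`, then `i ↦ W₁ i × W₂ i` is one of `N₁ × N₂` on
  `V₁ × V₂`; by uniqueness **`IsMonodromyWeightFiltration.eq_prod`** («la filtration `M` de `V` est somme des
  filtrations des `V_α`»); `isNilpotent_prodMap`; for the definition (char. `0`, finite dimension)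
  `monodromyWeightFiltration_prodMap`.
* §2 SIGN: **`IsMonodromyWeightFiltration.neg`** — `W(−N) = W(N)` (the axioms only see `±N^ℓ`).
* §3 DUALS (vector spaces over a field, any dimension): **`IsMonodromyWeightFiltration.dualAnnihilator`** — if `W` is a
  monodromy weight filtration of `N` centred at `c`, then `i ↦ (W_{−1−i})^⊥ ⊂ V^*` is one of the transpose `ᵗN`
  centred at `−c` («`M_i(V^*) = M_{−1−i}(V)^⊥`»); with §2 also for Deligne's `−ᵗN` (`…dualAnnihilator_neg`); by
  uniqueness `IsMonodromyWeightFiltration.eq_dualAnnihilator`; `isNilpotent_dualMap`; and for the definition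
  `monodromyWeightFiltration_dualMap`.

## Proof notes

Each clause of the axioms is transported: for products by Mathlib's `LinearMap.prodMap_map_prod`,
`prodMap_comap_prod`, `Submodule.prod_inf_prod`, `prod_sup_prod`; for duals, (1) and the injectivity half of (2) for
`ᵗN` are the duals of (1) and of the SURJECTIVITY half for `N`, elementwise, while the surjectivity half for `ᵗN` is
the dual of the injectivity half for `N` through `(A ∩ B)^⊥ = A^⊥ + B^⊥` (Mathlib `Subspace.dualAnnihilator_inf_eq`)
and `(f⁻¹ A)^⊥ = ᵗf (A^⊥)` (from `LinearMap.range_dualMap_eq_dualAnnihilator_ker`) — this is where a field is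
needed. `-- TODO(general form)`: (1.6.9) (i) (tensor products, characteristic `0`) and (iii) are not treated; infinite
direct sums are not treated.

## References

* [Deligne1980] P. Deligne, *La conjecture de Weil. II*, Publ. Math. IHÉS 52 (1980) 137–252: (1.6.2), (1.6.7),
  Prop. (1.6.9) (ii) (held text p0030–p0032).
-/

namespace Literature.AlgebraicGeometry.HodgeTheory

open Module

universe u w w'

/-! ## §1 Direct sums -/

section Prod

variable {R : Type u} [CommRing R] {V₁ : Type w} [AddCommGroup V₁] [Module R V₁] {V₂ : Type w'} [AddCommGroup V₂]
  [Module R V₂] {N₁ : V₁ →ₗ[R] V₁} {N₂ : V₂ →ₗ[R] V₂} {c : ℤ} {W₁ : ℤ → Submodule R V₁} {W₂ : ℤ → Submodule R V₂}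

/-- Powers of a product map. [folklore] -/
private theorem prodMap_pow (f : V₁ →ₗ[R] V₁) (g : V₂ →ₗ[R] V₂) (n : ℕ) :
    (f.prodMap g) ^ n = (f ^ n).prodMap (g ^ n) := by
  induction n with
  | zero => rw [pow_zero, pow_zero, pow_zero, LinearMap.prodMap_one]
  | succ n ih => rw [pow_succ, pow_succ, pow_succ, ih, LinearMap.prodMap_mul]

/-- **(1.6.7): «la filtration `M` de `V` est somme des filtrations … des `V_α`» — the monodromy weight filtration of a
direct sum is the direct sum of the filtrations**: if `W₁`, `W₂` are monodromy weight filtrations of `N₁`, `N₂` centred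
at `c`, then `i ↦ W₁ i × W₂ i` is a monodromy weight filtration of `N₁ × N₂` centred at `c`. Over any commutative ring.
[cite: Deligne1980, (1.6.7) (p0031)] -/
theorem IsMonodromyWeightFiltration.prod (h₁ : IsMonodromyWeightFiltration N₁ c W₁)
    (h₂ : IsMonodromyWeightFiltration N₂ c W₂) :
    IsMonodromyWeightFiltration (N₁.prodMap N₂) c (fun i => (W₁ i).prod (W₂ i)) where
  monotone := fun _ _ hij => Submodule.prod_mono (h₁.monotone hij) (h₂.monotone hij)
  exists_eq_bot := by
    obtain ⟨b₁, hb₁⟩ := h₁.exists_eq_bot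
    obtain ⟨b₂, hb₂⟩ := h₂.exists_eq_bot
    have e₁ : W₁ (min b₁ b₂) = ⊥ := eq_bot_iff.2 ((h₁.monotone (min_le_left _ _)).trans hb₁.le)
    have e₂ : W₂ (min b₁ b₂) = ⊥ := eq_bot_iff.2 ((h₂.monotone (min_le_right _ _)).trans hb₂.le)
    exact ⟨min b₁ b₂, by simp only [e₁, e₂, Submodule.prod_bot]⟩
  exists_eq_top := by
    obtain ⟨t₁, ht₁⟩ := h₁.exists_eq_top
    obtain ⟨t₂, ht₂⟩ := h₂.exists_eq_top
    have e₁ : W₁ (max t₁ t₂) = ⊤ := eq_top_iff.2 (ht₁.ge.trans (h₁.monotone (le_max_left _ _)))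
    have e₂ : W₂ (max t₁ t₂) = ⊤ := eq_top_iff.2 (ht₂.ge.trans (h₂.monotone (le_max_right _ _)))
    exact ⟨max t₁ t₂, by simp only [e₁, e₂, Submodule.prod_top]⟩
  map_le i := by
    rw [LinearMap.prodMap_map_prod]
    exact Submodule.prod_mono (h₁.map_le i) (h₂.map_le i)
  inf_comap_le ℓ := by
    rw [prodMap_pow, LinearMap.prodMap_comap_prod, Submodule.prod_inf_prod]
    exact Submodule.prod_mono (h₁.inf_comap_le ℓ) (h₂.inf_comap_le ℓ)
  le_map_sup ℓ := by
    rw [prodMap_pow, LinearMap.prodMap_map_prod, Submodule.prod_sup_prod]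
    exact Submodule.prod_mono (h₁.le_map_sup ℓ) (h₂.le_map_sup ℓ)

/-- **By uniqueness: every monodromy weight filtration of `N₁ × N₂` centred at `c` is the product of those of `N₁` and
`N₂`.** [cite: Deligne1980, (1.6.7) (p0031)] -/
theorem IsMonodromyWeightFiltration.eq_prod {W : ℤ → Submodule R (V₁ × V₂)}
    (h : IsMonodromyWeightFiltration (N₁.prodMap N₂) c W) (h₁ : IsMonodromyWeightFiltration N₁ c W₁)
    (h₂ : IsMonodromyWeightFiltration N₂ c W₂) : W = fun i => (W₁ i).prod (W₂ i) :=
  h.unique (h₁.prod h₂)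

/-- A product of nilpotent endomorphisms is nilpotent. [cite: Deligne1980, (1.6.7) (p0031)] -/
theorem isNilpotent_prodMap (h₁ : IsNilpotent N₁) (h₂ : IsNilpotent N₂) : IsNilpotent (N₁.prodMap N₂) := by
  obtain ⟨k₁, hk₁⟩ := h₁
  obtain ⟨k₂, hk₂⟩ := h₂
  refine ⟨max k₁ k₂, ?_⟩
  rw [prodMap_pow, pow_eq_zero_of_le (le_max_left _ _) hk₁, pow_eq_zero_of_le (le_max_right _ _) hk₂,
    LinearMap.prodMap_zero]

end Prod

section ProdDefinition

variable {k : Type u} [Field k] [CharZero k] {V₁ : Type w} [AddCommGroup V₁] [Module k V₁] [FiniteDimensional k V₁]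
  {V₂ : Type w'} [AddCommGroup V₂] [Module k V₂] [FiniteDimensional k V₂]

/-- **`W(N₁ × N₂)[−c] = W(N₁)[−c] × W(N₂)[−c]`** for THE monodromy weight filtration of `MonodromyWeightFiltrationSl2.lean`
(characteristic `0`, finite dimension). [cite: Deligne1980, (1.6.7) (p0031)] -/
theorem monodromyWeightFiltration_prodMap (N₁ : Module.End k V₁) (h₁ : IsNilpotent N₁) (N₂ : Module.End k V₂)
    (h₂ : IsNilpotent N₂) (c i : ℤ) :
    monodromyWeightFiltration (N₁.prodMap N₂) (isNilpotent_prodMap h₁ h₂) c i =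
      (monodromyWeightFiltration N₁ h₁ c i).prod (monodromyWeightFiltration N₂ h₂ c i) :=
  congrFun ((isMonodromyWeightFiltration_monodromyWeightFiltration _ (isNilpotent_prodMap h₁ h₂) c).eq_prod
    (isMonodromyWeightFiltration_monodromyWeightFiltration N₁ h₁ c)
    (isMonodromyWeightFiltration_monodromyWeightFiltration N₂ h₂ c)) i

end ProdDefinition

/-! ## §2 Change of sign: `W(−N) = W(N)` -/

section Neg

variable {R : Type u} [CommRing R] {V : Type w} [AddCommGroup V] [Module R V]
  {N : V →ₗ[R] V} {c : ℤ} {W : ℤ → Submodule R V}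

/-- `(−N)^ℓ = N^ℓ` or `−N^ℓ`. [folklore] -/
private theorem neg_pow_eq_or (N : V →ₗ[R] V) (ℓ : ℕ) : (-N) ^ ℓ = N ^ ℓ ∨ (-N) ^ ℓ = -(N ^ ℓ) := by
  rcases neg_one_pow_eq_or (Module.End R V) ℓ with h | h
  · left; rw [neg_pow, h, one_mul]
  · right; rw [neg_pow, h, neg_one_mul]

/-- **`W(−N) = W(N)`: a monodromy weight filtration of `N` is one of `−N`** (same centre) — the axioms involve only the
images and inverse images under `±N^ℓ`, which do not see the sign (Deligne's dual is `(V^*, −ᵗN)`). Over any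
commutative ring. [cite: Deligne1980, Prop. (1.6.9) (p0032)] -/
theorem IsMonodromyWeightFiltration.neg (hW : IsMonodromyWeightFiltration N c W) :
    IsMonodromyWeightFiltration (-N) c W where
  monotone := hW.monotone
  exists_eq_bot := hW.exists_eq_bot
  exists_eq_top := hW.exists_eq_top
  map_le i := by rw [Submodule.map_neg]; exact hW.map_le i
  inf_comap_le ℓ := by
    rcases neg_pow_eq_or N ℓ with h | h
    · rw [h]; exact hW.inf_comap_le ℓ
    · rw [h, Submodule.comap_neg]; exact hW.inf_comap_le ℓ
  le_map_sup ℓ := by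
    rcases neg_pow_eq_or N ℓ with h | h
    · rw [h]; exact hW.le_map_sup ℓ
    · rw [h, Submodule.map_neg]; exact hW.le_map_sup ℓ

end Neg

/-! ## §3 Duals: `M_i(V^*) = M_{−1−i}(V)^⊥` -/

section Dual

variable {K : Type u} [Field K] {V : Type w} [AddCommGroup V] [Module K V]
  {N : V →ₗ[K] V} {c : ℤ} {W : ℤ → Submodule K V}

/-- Transposition of powers. [folklore] -/
private theorem dualMap_pow (f : V →ₗ[K] V) (n : ℕ) : (f ^ n).dualMap = f.dualMap ^ n := by
  induction n with
  | zero =>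
    rw [pow_zero, pow_zero, Module.End.one_eq_id, Module.End.one_eq_id, LinearMap.dualMap_id]
  | succ n ih =>
    rw [pow_succ, pow_succ', Module.End.mul_eq_comp, ← LinearMap.dualMap_comp_dualMap, ih, Module.End.mul_eq_comp]

/-- `(f⁻¹ A)^⊥ = ᵗf (A^⊥)` for vector spaces (through `(Ker g)^⊥ = Im ᵗg` for `g : V → V'/A`). [folklore] -/
private theorem dualAnnihilator_comap_eq {V' : Type w'} [AddCommGroup V'] [Module K V'] (f : V →ₗ[K] V')
    (A : Submodule K V') : (A.comap f).dualAnnihilator = A.dualAnnihilator.map f.dualMap := by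
  have h1 : A.comap f = LinearMap.ker (A.mkQ ∘ₗ f) := by rw [LinearMap.ker_comp, Submodule.ker_mkQ]
  rw [h1, ← LinearMap.range_dualMap_eq_dualAnnihilator_ker, ← LinearMap.dualMap_comp_dualMap, LinearMap.range_comp,
    Submodule.range_dualMap_mkQ_eq]

/-- **PROPOSITION (1.6.9) (ii): «La filtration `M` d'un dual est le dual de la filtration `M` de l'espace de départ
(`M_i(V^*) = M_{−1−i}(V)^⊥`)»** (also Remarque (1.6.2): «La caractérisation (1.6.1) de `M` montre sa compatibilité au
passage à la catégorie duale»). For a vector space `V` over a field (any dimension): if `W` is a monodromy weight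
filtration of `N` centred at `c`, then `i ↦ (W_{−1−i})^⊥ ⊂ V^*` (Mathlib `Submodule.dualAnnihilator`) is a monodromy
weight filtration of the transpose `ᵗN = N.dualMap` centred at `−c`. Clause (1) and injectivity in (2) for `ᵗN` are
dual to (1) and surjectivity for `N`; surjectivity for `ᵗN` is dual to injectivity for `N` via `(A ∩ B)^⊥ = A^⊥ + B^⊥`
and `(f⁻¹A)^⊥ = ᵗf(A^⊥)`. [cite: Deligne1980, Prop. (1.6.9) (ii) (p0032)] -/
theorem IsMonodromyWeightFiltration.dualAnnihilator (hW : IsMonodromyWeightFiltration N c W) :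
    IsMonodromyWeightFiltration N.dualMap (-c) (fun i => (W (-1 - i)).dualAnnihilator) where
  monotone := fun _ _ hij => Submodule.dualAnnihilator_anti (hW.monotone (by omega))
  exists_eq_bot := by
    obtain ⟨t, ht⟩ := hW.exists_eq_top
    exact ⟨-1 - t, by simp only [show -1 - (-1 - t) = t by ring, ht, Submodule.dualAnnihilator_top]⟩
  exists_eq_top := by
    obtain ⟨b, hb⟩ := hW.exists_eq_bot
    exact ⟨-1 - b, by simp only [show -1 - (-1 - b) = b by ring, hb, Submodule.dualAnnihilator_bot]⟩
  map_le i := by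
    rintro _ ⟨φ, hφ, rfl⟩
    rw [SetLike.mem_coe, Submodule.mem_dualAnnihilator] at hφ
    rw [Submodule.mem_dualAnnihilator]
    intro w hw
    rw [LinearMap.dualMap_apply]
    refine hφ _ (hW.monotone (show -1 - (i - 2) - 2 ≤ -1 - i by omega)
      ((hW.map_le _) (Submodule.mem_map_of_mem hw)))
  inf_comap_le ℓ := by
    rintro φ ⟨h1, h2⟩
    rw [SetLike.mem_coe, Submodule.mem_dualAnnihilator] at h1
    rw [SetLike.mem_coe, Submodule.mem_comap, ← dualMap_pow, Submodule.mem_dualAnnihilator] at h2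
    rw [Submodule.mem_dualAnnihilator]
    intro w hw
    -- `w ∈ W_{c-ℓ} ⊂ N^ℓ W_{c+ℓ} + W_{c-ℓ-1}`, and `φ` kills both summands
    have hw' : w ∈ (W (c + ℓ)).map (N ^ ℓ) ⊔ W (c - ℓ - 1) :=
      hW.le_map_sup ℓ (hW.monotone (show -1 - (-c + ℓ - 1) ≤ c - ℓ by omega) hw)
    obtain ⟨_, ⟨v, hv, rfl⟩, z, hz, rfl⟩ := Submodule.mem_sup.1 hw'
    have e1 : φ ((N ^ ℓ) v) = 0 := by
      have := h2 v (hW.monotone (show c + ℓ ≤ -1 - (-c - ℓ - 1) by omega) hv)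
      rwa [LinearMap.dualMap_apply] at this
    rw [map_add, e1, zero_add]
    exact h1 z (hW.monotone (show c - ℓ - 1 ≤ -1 - (-c + ℓ) by omega) hz)
  le_map_sup ℓ := by
    -- `(W_{c+ℓ-1})^⊥ ⊂ (W_{c+ℓ} ∩ (N^ℓ)⁻¹ W_{c-ℓ-1})^⊥ = (W_{c+ℓ})^⊥ + ᵗN^ℓ (W_{c-ℓ-1})^⊥`
    have key := Submodule.dualAnnihilator_anti (hW.inf_comap_le ℓ)
    rw [Subspace.dualAnnihilator_inf_eq, dualAnnihilator_comap_eq, dualMap_pow, sup_comm] at key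
    rw [show -1 - (-c - (ℓ : ℤ)) = c + ℓ - 1 by ring, show -1 - (-c + (ℓ : ℤ)) = c - ℓ - 1 by ring,
      show -1 - (-c - (ℓ : ℤ) - 1) = c + ℓ by ring]
    exact key

/-- The same for Deligne's sign convention `(V^*, −ᵗN)`: `i ↦ (W_{−1−i})^⊥` is a monodromy weight filtration of `−ᵗN`
centred at `−c`. [cite: Deligne1980, Prop. (1.6.9) (ii) (p0032)] -/
theorem IsMonodromyWeightFiltration.dualAnnihilator_neg (hW : IsMonodromyWeightFiltration N c W) :
    IsMonodromyWeightFiltration (-N.dualMap) (-c) (fun i => (W (-1 - i)).dualAnnihilator) :=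
  hW.dualAnnihilator.neg

/-- **By uniqueness: every monodromy weight filtration of `ᵗN` centred at `−c` is `i ↦ (W_{−1−i})^⊥`.**
[cite: Deligne1980, Prop. (1.6.9) (ii) (p0032)] -/
theorem IsMonodromyWeightFiltration.eq_dualAnnihilator (hW : IsMonodromyWeightFiltration N c W)
    {W' : ℤ → Submodule K (Module.Dual K V)} (hW' : IsMonodromyWeightFiltration N.dualMap (-c) W') :
    W' = fun i => (W (-1 - i)).dualAnnihilator :=
  hW'.unique hW.dualAnnihilator

/-- The transpose of a nilpotent endomorphism is nilpotent: `(ᵗN)^k = ᵗ(N^k)`. [cite: Deligne1980, Prop. (1.6.9) (p0032)] -/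
theorem isNilpotent_dualMap (hN : IsNilpotent N) : IsNilpotent N.dualMap := by
  obtain ⟨k, hk⟩ := hN
  refine ⟨k, ?_⟩
  rw [← dualMap_pow, hk]
  ext φ v
  rw [LinearMap.dualMap_apply, LinearMap.zero_apply, LinearMap.zero_apply, LinearMap.zero_apply, map_zero]

end Dual

section DualDefinition

variable {k : Type u} [Field k] [CharZero k] {V : Type w} [AddCommGroup V] [Module k V] [FiniteDimensional k V]

/-- **(1.6.9) (ii) for THE filtration `W(N)[−c]` of `MonodromyWeightFiltrationSl2.lean` (characteristic `0`, finite
dimension): `W(ᵗN)[c]_i = (W(N)[−c]_{−1−i})^⊥`**, i.e. «`M_i(V^*) = M_{−1−i}(V)^⊥`».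
[cite: Deligne1980, Prop. (1.6.9) (ii) (p0032)] -/
theorem monodromyWeightFiltration_dualMap (N : Module.End k V) (hN : IsNilpotent N) (c i : ℤ) :
    monodromyWeightFiltration N.dualMap (isNilpotent_dualMap hN) (-c) i =
      (monodromyWeightFiltration N hN c (-1 - i)).dualAnnihilator :=
  congrFun ((isMonodromyWeightFiltration_monodromyWeightFiltration N hN c).eq_dualAnnihilator
    (isMonodromyWeightFiltration_monodromyWeightFiltration _ (isNilpotent_dualMap hN) (-c))) i

end DualDefinition

end Literature.AlgebraicGeometry.HodgeTheory
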